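import Literature.NumberTheory.Weil1964.ThetaLiftTransportMap
import Literature.NumberTheory.Weil1964.AdelicThetaWitness
import HarnessLib

/-!
# Transport of adelic theta lifts along a change of carriers with a scalar twist: the twist is
# automorphic, and non-vanishing of the lift is carrier-independent (Weil 1964 n° 41; Howe 1979 §3;
# Gelbart–Rogawski 1991 §3.1 Remark)

Topic `NumberTheory/Weil1964`; namespace `Literature.NumberTheory.Weil1964.ThetaKernelDatum` (sequel of
`ThetaLiftTransport`).  KERNEL ONLY: theorems; no `def`, no named fact, nothing of print asserted.

SETTING.  Two linearised adelic Weil representations of one dual pair on the common Schwartz–Bruhat space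
`𝒮(𝔸_F^ι)`: the «official» one `ω` of `GU × G` (arithmetic subgroups `ΓU`, `Γ`) and a «model» one `ω′` of
`GU′ × G′` (`ΓU′`, `Γ′`), identified along group ISOMORPHISMS `eU : GU′ ≃* GU`, `e : G′ ≃* G` matching the
arithmetic subgroups, up to a scalar character `c : GU′ × G′ →* ℂˣ`:

  `ω′(p′) Φ = c(p′) • ω(eU p′.1, e p′.2) Φ`                                              (T)

([Howe1979, §3]: the restriction of a Weil representation to a see-saw sub-pair is the sub-pair's own Weil
representation twisted by a character; [GelbartRogawski1991, §3.1 Remark p. 457 L4–13]: two splittings differ by a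
character).  Both give theta-kernel data `adelicOfDualPairRep ω …`, `adelicOfDualPairRep ω′ …`
(`ThetaDualPairDatum`; [Weil1964, n° 41]: `θ_Φ(x, h) = Θ(ω(x⁻¹, h⁻¹)Φ)`), each under its own hypothesis that the
arithmetic subgroups stabilise `Θ` (Weil's Théorème 6).  This file proves:

* §1 (private) `exists_continuousMap_descend` — a continuous right-`Δ`-invariant function on `H` IS a continuous
  function on `H ⧸ Δ` (topology; used to descend the multiplier);
* §2 **THE TWIST IS AUTOMORPHIC** (`twist_eq_one_of_mem`): from (T) and the two stabiliser conditions ALONE,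
  `c(γU′, γ′) = 1` for `γU′ ∈ ΓU′`, `γ′ ∈ Γ′` — because `Θ ≠ 0` (`thetaDistLM_ne_zero`, [Weil1964, n° 41]); hence
  the multipliers `x′ ↦ c(x′,1)⁻¹`, `y′ ↦ c(1,y′)⁻¹` descend to the quotients (`exists_twist_descend_left/right`);
* §3 the kernel relation `θ′_Φ(x′, y′) = c(x′,1)⁻¹ c(1,y′)⁻¹ θ_Φ(eU x′, e y′)` (`thetaFun_rel_of_twist`), the
  TRANSPORT OF THE LIFT `Θ′_Φ(f′)(ξ′) = c₁(ξ′) · Θ_Φ((c₂ f′) ∘ a⁻¹)(b ξ′)` (`thetaLift_apply_of_twist`; `a`, `b` the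
  coset congruences of `e`, `eU`, the official lift against the push-forward measure `a_* μ′`,
  [FleigEtAl2018, (12.37)]), and **`Θ′_Φ(f′) ≠ 0 ↔ Θ_Φ((c₂ f′) ∘ a⁻¹) ≠ 0`** (`thetaLift_ne_zero_iff_of_twist`);
* §4 (ed. 2) the same with the model test function made EXPLICIT: for `κ` descending `y′ ↦ c(1, y′)` (exists,
  `exists_twist_descend_right'`), **`Θ′_Φ((f ∘ a) · κ) ≠ 0 ↔ Θ_Φ(f) ≠ 0`** (`thetaLift_comp_mul_ne_zero_iff_of_twist`) —
  the consumption form for a non-vanishing theorem proved on the official carriers.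

USE: Rallis' inner product formula [Li1992, Thm 2.1] and its non-vanishing corollaries are typed over the official
carriers (`UnitaryDualPair.thetaKernelDatum`); a model built on isomorphic carriers (a change of frame on `U(V)(𝔸)`,
the norm-one idèles for `U(W)(𝔸)` of a hermitian line, a see-saw restricted Weil representation) consumes them
through `thetaLift_ne_zero_iff_of_twist`.  Nothing here is specific to that use.

## Mathlib / tree search
Tree: `ThetaLiftTransport` (`adelicOfDualPairRep_thetaFun_rel`), `ThetaLiftTransportMap`
(`thetaLift_cosetCongr_apply_map`, `thetaLift_ne_zero_iff_of_cosetCongr_map` — the two-carrier statements, needed since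
the two `adelicOfDualPairRep` data carry their own theta-initial topologies), `ThetaDualPairDatum` (`toHomUnits_mem_thetaStabilizer_iff`),
`AdelicThetaWitness` (`thetaDistLM_ne_zero`), `ThetaKernelDualPair` (`descend`, `descend_comp_mk`),
`MeasureTheory/Group/InvariantQuotientTransport` (`cosetCongr`).  Mathlib: `QuotientGroup.isOpenQuotientMap_mk`,
`Continuous.inv₀`, `Units.val_inv_eq_inv_val`, `LinearMap.ext`.

## References
* [Weil1964] A. Weil, Acta Math. 111 (1964) 143–211, Chap. III n° 41 Thm 6 p. 193.
* [Howe1979] R. Howe, *θ-series and invariant theory*, Proc. Sympos. Pure Math. 33.1 (1979), §3.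
* [GelbartRogawski1991] S. Gelbart, J. Rogawski, Invent. Math. 105 (1991), §3.1 Remark p. 457 L4–13.
* [FleigEtAl2018] P. Fleig, H. Gustafsson, A. Kleinschmidt, D. Persson, CUP (2018), §12.3 Def. 12.5 (12.37).
* [Li1992] J.-S. Li, J. reine angew. Math. 428 (1992), Thm 2.1 p. 184 (the consumer).
-/

set_option autoImplicit false

noncomputable section

open _root_.MeasureTheory Set Filter Function
open Literature.MeasureTheory.Group

namespace Literature.NumberTheory.Weil1964

namespace ThetaKernelDatum

/-! ## 1. Descending a continuous invariant function to the coset space -/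

section Descend

variable {H : Type*} [Group H] [TopologicalSpace H] [IsTopologicalGroup H] (Δ : Subgroup H)

/-- **A continuous right-`Δ`-invariant function on `H` descends to a continuous function on `H ⧸ Δ`** (the
quotient map is open; private plumbing). [folklore] -/
private theorem exists_continuousMap_descend {k : H → ℂ} (hk : Continuous k) (hΔ : ∀ (g : H), ∀ γ ∈ Δ, k (g * γ) = k g) :
    ∃ κ : C(H ⧸ Δ, ℂ), ∀ g : H, κ (QuotientGroup.mk g) = k g := by
  refine ⟨⟨descend Δ k hΔ, ?_⟩, fun g => rfl⟩
  rw [QuotientGroup.isOpenQuotientMap_mk.isQuotientMap.continuous_iff, descend_comp_mk]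
  exact hk

end Descend

/-! ## 2. The twist of two linearised Weil representations is automorphic -/

section Adelic

open NumberField Literature.NumberTheory.Automorphic

universe u₁ u₂ u₃ u₄

variable {F : Type} [Field F] [NumberField F] {ι : Type} [Fintype ι]

section Algebraic

variable {GU : Type u₁} [Group GU] {ΓU : Subgroup GU} {G : Type u₂} [Group G] {Γ : Subgroup G}
variable {GU' : Type u₃} [Group GU'] {ΓU' : Subgroup GU'} {G' : Type u₄} [Group G'] {Γ' : Subgroup G'}
variable (ω : Representation ℂ (GU × G) (piSchwartzBruhat F ι))
  (hrat : ∀ γU ∈ ΓU, ∀ γ ∈ Γ, ω.toHomUnits (γU, γ) ∈ thetaStabilizer F ι)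
  (ω' : Representation ℂ (GU' × G') (piSchwartzBruhat F ι))
  (hrat' : ∀ γU ∈ ΓU', ∀ γ ∈ Γ', ω'.toHomUnits (γU, γ) ∈ thetaStabilizer F ι)
  (eU : GU' ≃* GU) (hU : ∀ x' : GU', eU x' ∈ ΓU ↔ x' ∈ ΓU')
  (e : G' ≃* G) (hΓ : ∀ y' : G', e y' ∈ Γ ↔ y' ∈ Γ')
  (c : GU' × G' →* ℂˣ)
  (hωω' : ∀ (p' : GU' × G') (Φ : piSchwartzBruhat F ι), ω' p' Φ = ((c p' : ℂˣ) : ℂ) • ω (eU p'.1, e p'.2) Φ)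

include hrat hrat' hU hΓ hωω' in
/-- **THE TWIST IS AUTOMORPHIC.**  If the model representation is `ω′ = c • (ω ∘ (eU × e))` and BOTH `ω′(ΓU′ × Γ′)`
and `ω(ΓU × Γ)` stabilise the theta distribution `Θ` (Weil's Théorème 6 for each realisation), then
`c(γU′, γ′) = 1` on `ΓU′ × Γ′`: indeed `Θ(Φ) = Θ(ω′(γ)Φ) = c(γ) Θ(ω(eU × e γ)Φ) = c(γ) Θ(Φ)` and `Θ ≠ 0`.
[cite: Weil1964, Chap. III n° 41 Thm 6 p. 193; GelbartRogawski1991, §3.1 Remark p. 457 L4–13] -/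
theorem twist_eq_one_of_mem {γU' : GU'} (hγU' : γU' ∈ ΓU') {γ' : G'} (hγ' : γ' ∈ Γ') : c (γU', γ') = 1 := by
  obtain ⟨Φ, hΦ⟩ := DFunLike.ne_iff.mp (thetaDistLM_ne_zero F ι)
  rw [LinearMap.zero_apply] at hΦ
  have h1 := (toHomUnits_mem_thetaStabilizer_iff ω' (γU', γ')).1 (hrat' γU' hγU' γ' hγ') Φ
  have h2 := (toHomUnits_mem_thetaStabilizer_iff ω (eU γU', e γ')).1
    (hrat (eU γU') ((hU γU').2 hγU') (e γ') ((hΓ γ').2 hγ')) Φ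
  rw [hωω', map_smul, smul_eq_mul, h2] at h1
  have h3 : (((c (γU', γ') : ℂˣ) : ℂ) - 1) * thetaDistLM F ι Φ = 0 := by
    rw [sub_mul, one_mul, h1, sub_self]
  exact Units.val_eq_one.mp (sub_eq_zero.mp ((mul_eq_zero.mp h3).resolve_right hΦ))

include hrat hrat' hU hΓ hωω' in
/-- The `GU′`-multiplier `x′ ↦ c(x′, 1)⁻¹` is right-`ΓU′`-invariant. [cite: GelbartRogawski1991, §3.1 Remark p. 457 L4–13] -/
theorem twist_left_mul_mem (x' : GU') {γU' : GU'} (hγU' : γU' ∈ ΓU') :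
    (((c (x' * γU', 1))⁻¹ : ℂˣ) : ℂ) = (((c (x', 1))⁻¹ : ℂˣ) : ℂ) := by
  have h : ((x' * γU', (1 : G')) : GU' × G') = (x', 1) * (γU', 1) := by simp
  rw [h, map_mul, twist_eq_one_of_mem ω hrat ω' hrat' eU hU e hΓ c hωω' hγU' Γ'.one_mem, mul_one]

include hrat hrat' hU hΓ hωω' in
/-- The `G′`-multiplier `y′ ↦ c(1, y′)⁻¹` is right-`Γ′`-invariant. [cite: GelbartRogawski1991, §3.1 Remark p. 457 L4–13] -/
theorem twist_right_mul_mem (y' : G') {γ' : G'} (hγ' : γ' ∈ Γ') :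
    (((c (1, y' * γ'))⁻¹ : ℂˣ) : ℂ) = (((c (1, y'))⁻¹ : ℂˣ) : ℂ) := by
  have h : (((1 : GU'), y' * γ') : GU' × G') = (1, y') * (1, γ') := by simp
  rw [h, map_mul, twist_eq_one_of_mem ω hrat ω' hrat' eU hU e hΓ c hωω' ΓU'.one_mem hγ', mul_one]

include hrat hrat' hU hΓ hωω' in
/-- **The `GU′`-multiplier descends**: a function `c₁` on `GU′ ⧸ ΓU′` with `c₁(x′ ΓU′) = c(x′, 1)⁻¹`.
[cite: GelbartRogawski1991, §3.1 Remark p. 457 L4–13] -/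
theorem exists_twist_descend_left :
    ∃ c₁ : GU' ⧸ ΓU' → ℂ, ∀ x' : GU', c₁ (QuotientGroup.mk x') = (((c (x', 1))⁻¹ : ℂˣ) : ℂ) :=
  ⟨descend ΓU' (fun x' => (((c (x', 1))⁻¹ : ℂˣ) : ℂ))
      (fun x' _ hγU' => twist_left_mul_mem ω hrat ω' hrat' eU hU e hΓ c hωω' x' hγU'),
    fun _ => rfl⟩

end Algebraic

section Topological

variable {GU : Type u₁} [Group GU] [TopologicalSpace GU] [IsTopologicalGroup GU] [LocallyCompactSpace GU]
  {ΓU : Subgroup GU}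
variable {G : Type u₂} [Group G] [TopologicalSpace G] [IsTopologicalGroup G] [LocallyCompactSpace G] {Γ : Subgroup G}
variable {GU' : Type u₃} [Group GU'] [TopologicalSpace GU'] [IsTopologicalGroup GU'] [LocallyCompactSpace GU']
  {ΓU' : Subgroup GU'}
variable {G' : Type u₄} [Group G'] [TopologicalSpace G'] [IsTopologicalGroup G'] [LocallyCompactSpace G']
  {Γ' : Subgroup G'}
variable (ω : Representation ℂ (GU × G) (piSchwartzBruhat F ι)) (hω : HasThetaMajorants fun g Φ => ω g Φ)
  (hrat : ∀ γU ∈ ΓU, ∀ γ ∈ Γ, ω.toHomUnits (γU, γ) ∈ thetaStabilizer F ι)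
  (SK : Set (piSchwartzBruhat F ι)) (hSK : ∀ (h : G) (Φ : piSchwartzBruhat F ι), Φ ∈ SK → ω (1, h) Φ ∈ SK)
  (ω' : Representation ℂ (GU' × G') (piSchwartzBruhat F ι)) (hω' : HasThetaMajorants fun g Φ => ω' g Φ)
  (hrat' : ∀ γU ∈ ΓU', ∀ γ ∈ Γ', ω'.toHomUnits (γU, γ) ∈ thetaStabilizer F ι)
  (SK' : Set (piSchwartzBruhat F ι)) (hSK' : ∀ (h : G') (Φ : piSchwartzBruhat F ι), Φ ∈ SK' → ω' (1, h) Φ ∈ SK')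
  (eU : GU' ≃* GU) (hU : ∀ x' : GU', eU x' ∈ ΓU ↔ x' ∈ ΓU')
  (e : G' ≃* G) (hΓ : ∀ y' : G', e y' ∈ Γ ↔ y' ∈ Γ')
  (c : GU' × G' →* ℂˣ)
  (hωω' : ∀ (p' : GU' × G') (Φ : piSchwartzBruhat F ι), ω' p' Φ = ((c p' : ℂˣ) : ℂ) • ω (eU p'.1, e p'.2) Φ)

omit [TopologicalSpace GU] [IsTopologicalGroup GU] [LocallyCompactSpace GU] [TopologicalSpace G] [IsTopologicalGroup G]
  [LocallyCompactSpace G] [TopologicalSpace GU'] [IsTopologicalGroup GU'] [LocallyCompactSpace GU'] [LocallyCompactSpace G'] in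
include hrat hrat' hU hΓ hωω' in
/-- **The `G′`-multiplier descends to a CONTINUOUS function** `c₂` on `G′ ⧸ Γ′` with `c₂(y′ Γ′) = c(1, y′)⁻¹`, as
soon as `y′ ↦ c(1, y′)` is continuous. [cite: GelbartRogawski1991, §3.1 Remark p. 457 L4–13] -/
theorem exists_twist_descend_right (hc : Continuous fun y' : G' => ((c (1, y') : ℂˣ) : ℂ)) :
    ∃ c₂ : C(G' ⧸ Γ', ℂ), ∀ y' : G', c₂ (QuotientGroup.mk y') = (((c (1, y'))⁻¹ : ℂˣ) : ℂ) := by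
  have hc' : Continuous fun y' : G' => (((c (1, y'))⁻¹ : ℂˣ) : ℂ) := by
    simp_rw [Units.val_inv_eq_inv_val]
    exact hc.inv₀ fun y' => Units.ne_zero _
  exact exists_continuousMap_descend Γ' hc'
    (fun y' _ hγ' => twist_right_mul_mem ω hrat ω' hrat' eU hU e hΓ c hωω' y' hγ')

/-! ## 3. The kernel relation, the transported lift, and carrier-independence of non-vanishing -/

include hωω' in
/-- **The kernel relation**: `θ′_Φ(x′, y′) = c(x′,1)⁻¹ · c(1,y′)⁻¹ · θ_Φ(eU x′, e y′)`.
[cite: Howe1979, §3; GelbartRogawski1991, §3.1 Remark p. 457 L4–13] -/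
theorem thetaFun_rel_of_twist (Φ : piSchwartzBruhat F ι) (x' : GU') (y' : G') :
    (adelicOfDualPairRep (ΓU := ΓU') (Γ := Γ') ω' hω' hrat' SK' hSK').thetaFun Φ (x', y') =
      (((c (x', 1))⁻¹ : ℂˣ) : ℂ) * (((c (1, y'))⁻¹ : ℂˣ) : ℂ) *
        (adelicOfDualPairRep (ΓU := ΓU) (Γ := Γ) ω hω hrat SK hSK).thetaFun Φ (eU x', e y') := by
  have h := adelicOfDualPairRep_thetaFun_rel (ΓU := ΓU) (Γ := Γ) (ΓU' := ΓU') (Γ' := Γ') ω hω hrat SK hSK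
    ω' hω' hrat' SK' hSK' (eU.toMonoidHom.prodMap e.toMonoidHom) c (fun p' Φ => hωω' p' Φ) Φ (x', y')
  have hxy : ((x', y') : GU' × G') = (x', 1) * (1, y') := by simp
  have hψ : (eU.toMonoidHom.prodMap e.toMonoidHom) (x', y') = (eU x', e y') := rfl
  rw [h, hψ]
  congr 1
  rw [hxy, map_mul, mul_inv, Units.val_mul]

variable [CompactSpace (GU ⧸ ΓU)] [CompactSpace (G ⧸ Γ)] [MeasurableSpace (G ⧸ Γ)] [BorelSpace (G ⧸ Γ)]
variable [CompactSpace (GU' ⧸ ΓU')] [CompactSpace (G' ⧸ Γ')] [MeasurableSpace (G' ⧸ Γ')] [BorelSpace (G' ⧸ Γ')]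
  (μ' : Measure (G' ⧸ Γ')) [IsFiniteMeasure μ']

include hωω' in
/-- **TRANSPORT OF THE LIFT**: for the descended multipliers `c₁`, `c₂` (`c₁(x′ΓU′) = c(x′,1)⁻¹`,
`c₂(y′Γ′) = c(1,y′)⁻¹`, `c₂` continuous) and every `f′ ∈ C(G′ ⧸ Γ′)`,
`Θ′_Φ(f′)(ξ′) = c₁(ξ′) · Θ_Φ((c₂ · f′) ∘ a⁻¹)(b ξ′)` with `a = cosetCongr e`, `b = cosetCongr eU`, the official lift
against the push-forward `a_* μ′`. [cite: FleigEtAl2018, §12.3 Definition 12.5 (12.37); GelbartRogawski1991, §3.1 Remark p. 457 L4–13] -/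
theorem thetaLift_apply_of_twist (he : Continuous e) (hes : Continuous e.symm)
    (c₁ : GU' ⧸ ΓU' → ℂ) (hc₁ : ∀ x' : GU', c₁ (QuotientGroup.mk x') = (((c (x', 1))⁻¹ : ℂˣ) : ℂ))
    (c₂ : C(G' ⧸ Γ', ℂ)) (hc₂ : ∀ y' : G', c₂ (QuotientGroup.mk y') = (((c (1, y'))⁻¹ : ℂˣ) : ℂ))
    (Φ : piSchwartzBruhat F ι) (f' : C(G' ⧸ Γ', ℂ)) (ξ' : GU' ⧸ ΓU') :
    (adelicOfDualPairRep (ΓU := ΓU') (Γ := Γ') ω' hω' hrat' SK' hSK').thetaLift μ' Φ f' ξ' =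
      c₁ ξ' * (adelicOfDualPairRep (ΓU := ΓU) (Γ := Γ) ω hω hrat SK hSK).thetaLift
        (μ'.map (cosetCongr e Γ' Γ hΓ)) Φ
        ((c₂ * f').comp
          ⟨cosetCongr e.symm Γ Γ' (forall_symm_mem_iff e Γ' Γ hΓ),
            continuous_cosetCongr e.symm Γ Γ' (forall_symm_mem_iff e Γ' Γ hΓ) hes⟩)
        (cosetCongr eU ΓU' ΓU hU ξ') :=
  thetaLift_cosetCongr_apply_map (adelicOfDualPairRep (ΓU := ΓU) (Γ := Γ) ω hω hrat SK hSK)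
    (adelicOfDualPairRep (ΓU := ΓU') (Γ := Γ') ω' hω' hrat' SK' hSK') (fun Φ => Φ) eU hU e hΓ μ' he hes
    (thetaFun_rel_of_twist ω hω hrat SK hSK ω' hω' hrat' SK' hSK' eU e c hωω') c₁ hc₁ c₂ hc₂ Φ f' ξ'

include hU hrat hωω' in
/-- **NON-VANISHING OF THE THETA LIFT IS CARRIER-INDEPENDENT**: for every `f′ ∈ C(G′ ⧸ Γ′)` and the continuous
descended multiplier `c₂` (`c₂(y′Γ′) = c(1,y′)⁻¹`),
`Θ′_Φ(f′) ≠ 0 ↔ Θ_Φ((c₂ · f′) ∘ a⁻¹) ≠ 0` (official lift against `a_* μ′`, `a = cosetCongr e`).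
[cite: Li1992, p. 178; GelbartRogawski1991, §3.1 Remark p. 457 L4–13] -/
theorem thetaLift_ne_zero_iff_of_twist (he : Continuous e) (hes : Continuous e.symm)
    (c₂ : C(G' ⧸ Γ', ℂ)) (hc₂ : ∀ y' : G', c₂ (QuotientGroup.mk y') = (((c (1, y'))⁻¹ : ℂˣ) : ℂ))
    (Φ : piSchwartzBruhat F ι) (f' : C(G' ⧸ Γ', ℂ)) :
    (adelicOfDualPairRep (ΓU := ΓU') (Γ := Γ') ω' hω' hrat' SK' hSK').thetaLift μ' Φ f' ≠ 0 ↔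
      (adelicOfDualPairRep (ΓU := ΓU) (Γ := Γ) ω hω hrat SK hSK).thetaLift (μ'.map (cosetCongr e Γ' Γ hΓ)) Φ
          ((c₂ * f').comp
            ⟨cosetCongr e.symm Γ Γ' (forall_symm_mem_iff e Γ' Γ hΓ),
              continuous_cosetCongr e.symm Γ Γ' (forall_symm_mem_iff e Γ' Γ hΓ) hes⟩) ≠ 0 := by
  obtain ⟨c₁, hc₁⟩ := exists_twist_descend_left ω hrat ω' hrat' eU hU e hΓ c hωω'
  exact thetaLift_ne_zero_iff_of_cosetCongr_map (adelicOfDualPairRep (ΓU := ΓU) (Γ := Γ) ω hω hrat SK hSK)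
    (adelicOfDualPairRep (ΓU := ΓU') (Γ := Γ') ω' hω' hrat' SK' hSK') (fun Φ => Φ) eU hU e hΓ μ' he hes
    (thetaFun_rel_of_twist ω hω hrat SK hSK ω' hω' hrat' SK' hSK' eU e c hωω') (fun x' => Units.ne_zero _)
    c₁ hc₁ c₂ hc₂ Φ f'

/-! ## 4. The official lift of `f` versus the model lift of the TWISTED PULL-BACK `(f ∘ a) · κ` -/

include hU hrat hωω' in
/-- **THE MATCHED MODEL TEST FUNCTION, EXPLICITLY.**  Let `κ` be the continuous function on `G′ ⧸ Γ′` descending the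
`G′`-component `y′ ↦ c(1, y′)` of the twist (it exists as soon as that component is continuous: §2, and it is
nowhere zero).  Then for every `f ∈ C(G ⧸ Γ)` the model lift of the twisted pull-back `(f ∘ a) · κ` (`a = cosetCongr e`)
vanishes iff the official lift of `f` (against `a_* μ′`) does:
`Θ′_Φ((f ∘ a) · κ) ≠ 0 ↔ Θ_Φ(f) ≠ 0` — the form in which a non-vanishing theorem for the OFFICIAL datum (Rallis'
inner product formula and its corollaries, [Li1992, Thm 2.1]) is consumed by a model built on isomorphic carriers.
[cite: Li1992, p. 178; GelbartRogawski1991, §3.1 Remark p. 457 L4–13] -/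
theorem thetaLift_comp_mul_ne_zero_iff_of_twist (he : Continuous e) (hes : Continuous e.symm)
    (κ : C(G' ⧸ Γ', ℂ)) (hκ : ∀ y' : G', κ (QuotientGroup.mk y') = ((c (1, y') : ℂˣ) : ℂ))
    (Φ : piSchwartzBruhat F ι) (f : C(G ⧸ Γ, ℂ)) :
    (adelicOfDualPairRep (ΓU := ΓU') (Γ := Γ') ω' hω' hrat' SK' hSK').thetaLift μ' Φ
        (f.comp ⟨cosetCongr e Γ' Γ hΓ, continuous_cosetCongr e Γ' Γ hΓ he⟩ * κ) ≠ 0 ↔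
      (adelicOfDualPairRep (ΓU := ΓU) (Γ := Γ) ω hω hrat SK hSK).thetaLift (μ'.map (cosetCongr e Γ' Γ hΓ)) Φ f ≠ 0 := by
  have hκ0 : ∀ q' : G' ⧸ Γ', κ q' ≠ 0 := fun q' => by
    induction q' using QuotientGroup.induction_on with
    | H y' => rw [hκ]; exact Units.ne_zero _
  let c₂ : C(G' ⧸ Γ', ℂ) := ⟨fun q' => (κ q')⁻¹, κ.continuous.inv₀ hκ0⟩
  have hc₂ : ∀ y' : G', c₂ (QuotientGroup.mk y') = (((c (1, y'))⁻¹ : ℂˣ) : ℂ) := fun y' => by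
    change (κ (QuotientGroup.mk y'))⁻¹ = _
    rw [hκ, Units.val_inv_eq_inv_val]
  have key := thetaLift_ne_zero_iff_of_twist ω hω hrat SK hSK ω' hω' hrat' SK' hSK' eU hU e hΓ c hωω' μ' he hes c₂ hc₂ Φ
    (f.comp ⟨cosetCongr e Γ' Γ hΓ, continuous_cosetCongr e Γ' Γ hΓ he⟩ * κ)
  have hf : (c₂ * (f.comp ⟨cosetCongr e Γ' Γ hΓ, continuous_cosetCongr e Γ' Γ hΓ he⟩ * κ)).comp
      ⟨cosetCongr e.symm Γ Γ' (forall_symm_mem_iff e Γ' Γ hΓ),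
        continuous_cosetCongr e.symm Γ Γ' (forall_symm_mem_iff e Γ' Γ hΓ) hes⟩ = f := by
    ext q
    simp only [ContinuousMap.comp_apply, ContinuousMap.mul_apply, ContinuousMap.coe_mk, cosetCongr_apply_symm]
    change (κ _)⁻¹ * (f q * κ _) = f q
    rw [mul_comm (f q), ← mul_assoc, inv_mul_cancel₀ (hκ0 _), one_mul]
  rw [hf] at key
  exact key

omit [TopologicalSpace GU] [IsTopologicalGroup GU] [LocallyCompactSpace GU] [TopologicalSpace G] [IsTopologicalGroup G]
  [LocallyCompactSpace G] [TopologicalSpace GU'] [IsTopologicalGroup GU'] [LocallyCompactSpace GU'] [LocallyCompactSpace G']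
  [MeasurableSpace (G ⧸ Γ)] [CompactSpace (G' ⧸ Γ')] [MeasurableSpace (G' ⧸ Γ')] [BorelSpace (G' ⧸ Γ')] in
include hrat hrat' hU hΓ hωω' in
/-- **The `G′`-component of the twist descends** (no inverse): a continuous `κ` on `G′ ⧸ Γ′` with `κ(y′Γ′) = c(1, y′)`, as
soon as `y′ ↦ c(1, y′)` is continuous — the `κ` of `thetaLift_comp_mul_ne_zero_iff_of_twist`.
[cite: GelbartRogawski1991, §3.1 Remark p. 457 L4–13] -/
theorem exists_twist_descend_right' (hc : Continuous fun y' : G' => ((c (1, y') : ℂˣ) : ℂ)) :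
    ∃ κ : C(G' ⧸ Γ', ℂ), ∀ y' : G', κ (QuotientGroup.mk y') = ((c (1, y') : ℂˣ) : ℂ) :=
  exists_continuousMap_descend Γ' hc fun y' γ' hγ' => by
    have h : (((1 : GU'), y' * γ') : GU' × G') = (1, y') * (1, γ') := by simp
    rw [h, map_mul, twist_eq_one_of_mem ω hrat ω' hrat' eU hU e hΓ c hωω' ΓU'.one_mem hγ', mul_one]

end Topological

end Adelic

end ThetaKernelDatum

end Literature.NumberTheory.Weil1964
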